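import Summits.QuantumFields.YangMills.Theorems.BalabanUVNodesN22W1RelCentredMembersOfDatumLG
import Summits.QuantumFields.YangMills.Theorems.BalabanUVNodesN22W1RelCentredMembersOfDatumLGCentred
import Summits.QuantumFields.YangMills.Theorems.BalabanUVNodesN22W1RelCentredMembersOfDatumTails
import Summits.QuantumFields.YangMills.Theorems.BalabanUVNodesN22W1RelCentredCentreOfDatum
import Literature.MathematicalPhysics.QuantumFieldTheory.Balaban1983to89.Node00.HistoryTermDatum214LocalGrowth
import Literature.MathematicalPhysics.QuantumFieldTheory.Balaban1983to89.Node00.HistoryTermDatum214Inputs226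

/-!
# BalabanUVNodes ∕ node N22 = NE9 — THE FOUR MEMBER STATEMENTS OF THE WINDOW-DILATED ROAD READ OFF def-W1's LOCATED RECORDS AT A FIXED HISTORY
# (module J88-A): holomorphy in the dilation parameter, the (2.26) weight, the CENTRED letter about a coupling-blind centre and the centre's own weight,
# for def-W1's member `TermDatum214.memberTF χᵘ χᶜᵘ 𝒲 𝒪 t` of base point `t`, from ONE `Inputs226Holo` record (W1-8: NODE A's kernel letters, regions,
# (2.22), numerics), ONE `LocalGrowthInputs` record (W1-12: Lemma 2's local growth letters of the coupling-free potentials at the history `old` and the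
# configuration `φ`), the `UnscaledBoxLaws` (W1-12 §2), the unscaled-field law read at the base point, the primed letters of the dilation ball and ONE
# master rate ∕ width — modules J10a §1, J10b §3∕§4, J7a §1∕§2∕§4, J8 BY NAME

Cell `pub-ymgap`, HUMAN RULING D-0062 (Track A), R134 seat `pub-ymgap-dag-n22-c` (strategy s1: «the history-Lipschitz estimate (2.40)–(2.41) p. 21 of [II] on the W1 object»),
generation 21, module J88-A.  THEOREMS ONLY (no `def`, no `sorry`, standard axioms); `--kind proof --supports stmt-QuantumFields-27366 --as helper` (K3⁸), COUNT-NEUTRAL.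
Imports this lane's g8 modules J10a `…MembersOfDatumLG` (member holomorphy ∕ weight from LOCAL growth letters), J10b `…MembersOfDatumLGCentred` (centred piece,
large-field members), g7 J7a `…MembersOfDatumTails` (box tail, `b`-free box-free centre, assembly algebra), J8 `…CentreOfDatum` (the centre's (P)), and
node00-def-W1's W1-12 `Node00/HistoryTermDatum214LocalGrowth` (`LocalGrowthInputs`, `UnscaledBoxLaws`) ∕ W1-8 `…Inputs226` (`Inputs226Holo`).  Nothing re-declared.

WHY.  After modules J87 ∕ J81p (g20) the ROAD-2 ∕ ROAD-1 bills of N22 at def-W1's term data display, per slice `(K, k, old ∈ AdmHist, X, φ ∈ sp, Z ⊆ X, s ∈ terms)`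
and base point `t ∈ ]0, γ]`, ONE located record `ι : Inputs226Holo c Z s ↑t old φ a a₅` (+ extras) from which g7 J6 reads `hMdiff ∧ hMbd`, but STILL the coupling-blind
centre `T₀` with its weight `hT₀` and the centred member letter `hMcen : ‖memberTF t … b old φ − T₀‖ ≤ Mv·t²·(weight·e^{a₅|Z|})` on `ball 1 ρ_b`.  g8's knit J10c
(`…DatumKnitLG`, K3⁷ world) derived all of them from ONE `SliceInputsLG` record per slice — a Summit-side structure whose older-term letters are quantified over
the admissible class of the tables OF RECORD (`spaceOfRecord Sg Rz cs`), hence not pluggable into the K3⁸ bills over generic tables `sp K`.  But the bills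
bind the history FIRST (`∀ old ∈ AdmHist (sp K) E₀ r₁ k ∧ old 0 = 0, …`), and node00-def-W1 typed (W1-12, on this lane's g7 ask) the local growth schema AT A
FIXED HISTORY as ONE record `𝔇.LocalGrowthInputs χᵘ 𝒲 𝒪 Z s old φ Uτ` whose fields ARE, byte for byte, the last-line binders of dag-n10-c's `_localGrowth_perBond`
engines (46 §5 ∕ 47 §2–§3 ∕ 47 v1.2) that J10a ∕ J10b read at the datum.  THIS FILE re-keys J10c's member branches on the PAIR `(ι, lg)` of def-W1 records at a
fixed history: no Summit-side structure, no class, no tables — the consumer's `old` is whatever the bill bound.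
* §0 faces: `sum_R_c₀_le_of_primedWidth` (`Σ R c₀ ≤ w_m` from the primed width row), `norm_sum_tau_older_zero_le_of_localGrowth` (the centre's
  `Σ|τ||𝒪(old,φ;Y,0)| ≤ w_m` on `Π ι.Uτ`), `sum_tau_older_zero_le_quadratic_of_localGrowth` (its quadratic-form shape with any `a₀ ≥ 0`), `le_rate_of_le_rate` (the rate
  step `x ≤ T·t²·W`, `T ≤ Mv` ⇒ `x ≤ Mv·t²·W` over real VARIABLES — no arithmetic tactic ever sees a term of the datum).
* §1 ★ `differentiableOn_and_norm_memberTF_le_weight_of_records` — J10a §1 keyed on `(ι, lg)`, the box laws, the law's identities `chiY₀(↑t)· = χᵘ(t·)`,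
  `chicP(↑t)· = χᶜᵘ(t·)` at the base point (for (2.22)), the primed letters `KE KG′ KCs′ θΓ′ θC′ θE′` and ONE master rate `a_m` ∕ width `w_m` dominating
  the member's `(1+ρ_b)²·2ρm₃` ∕ `(1+ρ_b)²·ΣR(c₀+c₁ρ)`, with the capstone rows `hαc ∕ hsmall ∕ hvol` at `γ₂ + a_m`, `w_m`.
* §2 ★★ `norm_memberTF_sub_centre_le_of_records` — THE CENTRED LETTER `hMcen` about `V := if |P(s)| = 0 then term(A, Γ, F214 0 1 1 𝐃 (Y ↦ 𝒪(old,φ;Y,0))) else 0`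
  (the `if` on `s.2.card = 0`: `Nat` decidability, instance-robust): on `|P| = 0` the three pieces — J10b §3 (centred (2.15) from local growth letters, rate
  `δ`, closure rows `2δ + 8ρm₃ ≤ a_m`, `hwc ≤ e^{w_m}`), J7a §1 (box tail at a free rate `κ_b ≤ γ₂ + a_m` under the BOX LAW `χᵘχᶜᵘ(t·B) = 1 on ⟨B,B⟩ < R_b²`),
  J7a §2 (the box-free centre is `b`-free) and the rate `e^{−½κ_bR_b²} ≤ T·t²`, `1 + T ≤ Mv` (`vertexLetter_of_threePieces`); on `|P| ≠ 0` J10b §4 (the (2.22)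
  surplus `e^{−½γ₂(r_P²−r₁²)}` with `a ≤ γ₂r₁²`) and the rate `≤ T′·t²`, `T′ ≤ Mv` (`vertexLetter_of_largeField`).  The box block is asked ONLY on `|P| = 0` and
  the surplus block ONLY on `|P| ≠ 0` (director-ym №193: the unconditional conjunction is VACUOUS — (2.22) with `|P| ≥ 1` contradicts the box law at `B = 0`).
* §3 ★ `norm_centre_le_weight_of_records` — THE CENTRE's WEIGHT `hT₀`: J8 along the constant curve (`Re A ≻ 0` = `ι.hA`, UNPRIMED θ-rows of `ι`), `0` else.
EVERY numeric row of §1–§3 is ONE of: `ι`'s own, the primed block, the master block at `(γ₂ + a_m, w_m)` — the engines' per-piece rates (`γ₂ + a′`, `γ₂ + a_c`,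
`κ + a₀`, `α₀`, `γ₂ + a₂₀`) are all INSTANTIATED at the master rate (larger rate = stronger smallness row, same conclusion; the box tail's `a₀ := γ₂ + a_m − κ_b`).

HONEST FRAMING (binding).  Count-neutral READINGS of landed theorems BY NAME (one application each + bookkeeping inequalities between nonnegative reals); NO
estimate of Bałaban's is proved or asserted here; every located input is a HYPOTHESIS (NODE A's kernel record, def-W1 ∕ N09's local growth letters and box
laws, the numerics); (S-vertex-T′) is NOT PRINTED as an estimate ([I] (2.13) p. 268 records the first-order vanishing at `g_k = 0`; the second order is the
producer's centred (2.15), lens T21); A6: `Inputs226Holo` ∕ `LocalGrowthInputs` ∕ `UnscaledBoxLaws` are separately consistent (W1-8 §3, W1-12 §3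
`localGrowthInputsZero`, `unscaledBoxLaws_const`); a JOINT inhabitant with the numeric rows is NOT exhibited here.  N22 ∕ N10 ∕ N09 ∕ NODE A NOT discharged;
K3⁸ untouched; counts unmoved; one finite 𝕋⁴ programme at fixed ε — NOTHING about the continuum limit, ℝ⁴, infinite volume, OS axioms, a mass gap or Clay.
References (TYPES only): [II] = Bałaban, CMP 116 (1988) (1.34)–(1.36) p. 9, Lemma 2 (1.41)–(1.43) p. 11, (2.2)–(2.3) p. 12, (2.14)–(2.15) p. 15, (2.16)–(2.22)
p. 16, (2.23)–(2.26) p. 17, (1.26) p. 8; [I] = CMP 109 (1987) §1 p. 263, (2.8)–(2.13) pp. 266–268.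
-/

noncomputable section

namespace YMDAG.N22.W1

open Set Metric Matrix
open scoped BigOperators
open Literature.MathematicalPhysics.QuantumFieldTheory.Balaban1983to89
open Literature.MathematicalPhysics.QuantumFieldTheory.Balaban1983to89.B13Term214 (term214 core214 F214)
open Literature.MathematicalPhysics.QuantumFieldTheory.Balaban1983to89.TreeLengthTorus (TPt TDom tsys)
open Literature.MathematicalPhysics.QuantumFieldTheory.Balaban1983to89.B13Lemma3TorusTerms (weight weight_nonneg)
open Literature.MathematicalPhysics.QuantumFieldTheory.Balaban1983to89.B13Bound143 (invTau)
open Literature.MathematicalPhysics.QuantumFieldTheory.Balaban1983to89.B9Thm37GlueTorus (tdist1)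
open Literature.MathematicalPhysics.QuantumFieldTheory.Balaban1983to89.B5TorusCover (UT)
open Literature.MathematicalPhysics.QuantumFieldTheory.Balaban1983to89.Node00.Sect2 (domSys domCount CPair)
open Literature.MathematicalPhysics.QuantumFieldTheory.Balaban1983to89.Node00.W1

variable {c₀ : B13.Consts} {P : Params} {𝔸 : Type*} {M k L : ℕ} [NeZero L] (𝔇 : TermDatum214 c₀ P 𝔸 M k L)
  (χu χcu : 𝔇.UnscaledChi) (𝒲 : 𝔇.UnscaledWilson) (𝒪 : 𝔇.UnscaledOlder)

/-! ## §0 Faces: the centre's `Σ|τ||𝒪(old, φ; Y, 0)|` letters from the local growth record and the primed width row -/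

variable {𝔇 χu 𝒲 𝒪} in
/-- **`Σ_{Y∈𝐃} R(Y)c₀(Y) ≤ w_m` FROM THE PRIMED WIDTH ROW** `(1+ρ_b)²·Σ R(Y)(c₀(Y) + c₁(Y)ρ) ≤ w_m` (`0 ≤ ρ_b`; `R, c₁ ≥ 0` on `𝐃`, `c₀ ≥ ‖𝒪(Y,0)‖ ≥ 0` by (L0), `ρ > 0`).
[cite: Balaban1988RG2Cluster, (2.18)-(2.20) p.16 (bookkeeping)] -/
theorem sum_R_c₀_le_of_primedWidth {Z : (domSys P M (k + 1)).Dom} {s : TermLabel P M k L} {old : OlderTerms P 𝔸 M k} {φ : CPair P 𝔸}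
    {Uτ : TDom P.d (L * domCount P M (k + 1)) → Set ℂ} (lg : 𝔇.LocalGrowthInputs χu 𝒲 𝒪 Z s old φ Uτ) {ρb wm : ℝ} (hρb0 : 0 ≤ ρb)
    (hw' : (1 + ρb) ^ 2 * (∑ Y ∈ s.1, lg.R Y * (lg.c₀ Y + lg.c₁ Y * lg.ρ)) ≤ wm) :
    ∑ Y ∈ s.1, lg.R Y * lg.c₀ Y ≤ wm := by
  have h1 : ∑ Y ∈ s.1, lg.R Y * lg.c₀ Y ≤ ∑ Y ∈ s.1, lg.R Y * (lg.c₀ Y + lg.c₁ Y * lg.ρ) :=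
    Finset.sum_le_sum fun Y hY => mul_le_mul_of_nonneg_left (le_add_of_nonneg_right (mul_nonneg (lg.hc₁ Y hY) lg.hρ.le)) (lg.hR Y hY)
  have h0 : 0 ≤ ∑ Y ∈ s.1, lg.R Y * (lg.c₀ Y + lg.c₁ Y * lg.ρ) :=
    Finset.sum_nonneg fun Y hY => mul_nonneg (lg.hR Y hY) (add_nonneg ((norm_nonneg _).trans (lg.h0 Y hY)) (mul_nonneg (lg.hc₁ Y hY) lg.hρ.le))
  have h2 : (1 : ℝ) ≤ (1 + ρb) ^ 2 := by nlinarith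
  calc ∑ Y ∈ s.1, lg.R Y * lg.c₀ Y ≤ ∑ Y ∈ s.1, lg.R Y * (lg.c₀ Y + lg.c₁ Y * lg.ρ) := h1
    _ = 1 * ∑ Y ∈ s.1, lg.R Y * (lg.c₀ Y + lg.c₁ Y * lg.ρ) := (one_mul _).symm
    _ ≤ (1 + ρb) ^ 2 * ∑ Y ∈ s.1, lg.R Y * (lg.c₀ Y + lg.c₁ Y * lg.ρ) := mul_le_mul_of_nonneg_right h2 h0
    _ ≤ wm := hw'

variable {𝔇 χu 𝒲 𝒪} in
/-- **THE CENTRE's `Σ|τ||𝒪(old, φ; Y, 0)| ≤ w_m` ON THE τ-REGION** — (L0) `‖𝒪(Y,0)‖ ≤ c₀(Y)`, `‖τ(Y)‖ ≤ R(Y)` on `Uτ Y` and `Σ R c₀ ≤ w_m` (J10c's `SliceInputsLG.hw₀U`, at a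
fixed history). [cite: Balaban1988RG2Cluster, (2.18)-(2.20) p.16 and Lemma 2 p.11] -/
theorem norm_sum_tau_older_zero_le_of_localGrowth {Z : (domSys P M (k + 1)).Dom} {s : TermLabel P M k L} {old : OlderTerms P 𝔸 M k} {φ : CPair P 𝔸}
    {Uτ : TDom P.d (L * domCount P M (k + 1)) → Set ℂ} (lg : 𝔇.LocalGrowthInputs χu 𝒲 𝒪 Z s old φ Uτ) {wm : ℝ}
    (hw : ∑ Y ∈ s.1, lg.R Y * lg.c₀ Y ≤ wm) :
    ∀ τ : TDom P.d (L * domCount P M (k + 1)) → ℂ, (∀ Y, τ Y ∈ Uτ Y) → ∑ Y ∈ s.1, ‖τ Y‖ * ‖𝒪 Z s old φ Y 0‖ ≤ wm := fun τ hτ =>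
  (Finset.sum_le_sum fun Y hY => mul_le_mul (lg.hUτR Y hY (τ Y) (hτ Y)) (lg.h0 Y hY) (norm_nonneg _) (lg.hR Y hY)).trans hw

variable {𝔇 χu 𝒲 𝒪} in
/-- **THE CENTRE's QUADRATIC-FORM LETTER** `Σ|τ||𝒪(old, φ; Y, 0)| ≤ ½a₀⟨B,B⟩ + w_m` for any `a₀ ≥ 0` (J10c's `SliceInputsLG.h220V0`, at a fixed history).
[cite: Balaban1988RG2Cluster, (2.18)-(2.20) p.16 and Lemma 2 p.11] -/
theorem sum_tau_older_zero_le_quadratic_of_localGrowth {Z : (domSys P M (k + 1)).Dom} {s : TermLabel P M k L} {old : OlderTerms P 𝔸 M k}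
    {φ : CPair P 𝔸} {Uτ : TDom P.d (L * domCount P M (k + 1)) → Set ℂ} (lg : 𝔇.LocalGrowthInputs χu 𝒲 𝒪 Z s old φ Uτ) {a₀ wm : ℝ} (ha₀ : 0 ≤ a₀)
    (hw : ∑ Y ∈ s.1, lg.R Y * lg.c₀ Y ≤ wm) :
    ∀ τ : TDom P.d (L * domCount P M (k + 1)) → ℂ, (∀ Y, τ Y ∈ Uτ Y) → ∀ B : (𝔇.𝒦 Z s).Λ → ℝ,
      ∑ Y ∈ s.1, ‖τ Y‖ * ‖𝒪 Z s old φ Y 0‖ ≤ a₀ / 2 * (B ⬝ᵥ B) + wm := fun τ hτ B =>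
  (norm_sum_tau_older_zero_le_of_localGrowth lg hw τ hτ).trans
    (le_add_of_nonneg_left (mul_nonneg (div_nonneg ha₀ two_pos.le) (Finset.sum_nonneg fun i _ => mul_self_nonneg (B i))))

variable {𝔇 χu 𝒲 𝒪} in
/-- The rate step of the assembly: `x ≤ T·u·W`, `T ≤ Mv`, `0 ≤ u·W` ⇒ `x ≤ Mv·u·W` (stated over real VARIABLES so that no term of the datum is normalised).
[cite: Balaban1987RG1, (2.13) p.268] (elementary) -/
theorem le_rate_of_le_rate {x T Mv u W : ℝ} (huW : 0 ≤ u * W) (h : x ≤ T * u * W) (hT : T ≤ Mv) : x ≤ Mv * u * W := by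
  rw [mul_assoc] at h ⊢
  exact h.trans (mul_le_mul_of_nonneg_right hT huW)

/-! ## §1 ★ (S-last-T′)ʷ — holomorphy in the dilation parameter and the (2.26) weight — read off the records `(ι, lg)` -/

open Classical in
/-- ★ **THE MEMBER's HOLOMORPHY IN `b` AND (2.26) WEIGHT ON `ball 1 ρ_b`, READ OFF ONE `Inputs226Holo` RECORD AND ONE `LocalGrowthInputs` RECORD AT THE HISTORY `old`** —
module J10a §1 `differentiableOn_and_norm_memberOfDatum_le_weight_of_localGrowth` (dag-n10-c 47 §2–§3 `_localGrowth_perBond`) for def-W1's member `𝔇.memberTF χᵘ χᶜᵘ 𝒲 𝒪 t`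
of base point `t > 0` (W1-11; `memberTF_apply` is `rfl` on J10a's lambda), every last-line binder read FIELD BY FIELD: NODE A's kernel letters, the regions, (2.22) and the
θ∕K∕c_E∕g letters from `ι : 𝔇.Inputs226Holo c Z s ↑t old φ a a₅` (its (2.22) row transported to the unscaled boxes at the base point by the law's identities
`hEχ ∕ hEχc`), Lemma 2's LOCAL growth letters (L0), (ℓ1), (L4), the τ-radii, the bond supports, the per-bond multiplicity `lg.m₃` (derived face, (1.26) on the torus),
the box-support law and the `Y`-locality from `lg : 𝔇.LocalGrowthInputs χᵘ 𝒲 𝒪 Z s old φ ι.Uτ`, the signs ∕ measurability of the boxes from `hB : 𝔇.UnscaledBoxLaws χᵘ χᶜᵘ Z s`,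
the primed letters of the dilation ball `|b − 1| < ρ_b < 1` and the master rows at `(γ₂ + a_m, w_m)` with `(1+ρ_b)²·2ρm₃ ≤ a_m`, `(1+ρ_b)²·ΣR(c₀+c₁ρ) ≤ w_m`.
One application; no estimate proved here.
[cite: Balaban1988RG2Cluster, (1.34)-(1.36) p.9, Lemma 2 (1.41)-(1.43) p.11, (2.2)-(2.3) p.12, (2.14)-(2.15) p.15, (2.16)-(2.22) p.16, (2.23)-(2.26) p.17, (1.26) p.8; Balaban1987RG1, §1 p.263, (2.9)-(2.13) pp.266-268] -/
theorem differentiableOn_and_norm_memberTF_le_weight_of_records {c : B13.Consts} (hκ₁ : 1 ≤ c.κ₁) (hα₆ : c.α₆ ≠ 0)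
    (Z : (domSys P M (k + 1)).Dom) (s : TermLabel P M k L) (old : OlderTerms P 𝔸 M k) (φ : CPair P 𝔸) {t : ℝ} (ht : 0 < t) {a a₅ : ℝ}
    (ι : 𝔇.Inputs226Holo c Z s (t : ℂ) old φ a a₅) (lg : 𝔇.LocalGrowthInputs χu 𝒲 𝒪 Z s old φ ι.Uτ) (hB : 𝔇.UnscaledBoxLaws χu χcu Z s)
    (hEχ : ∀ B, 𝔇.chiY₀ Z s (t : ℂ) B = χu Z s (t • B)) (hEχc : ∀ B, 𝔇.chicP Z s (t : ℂ) B = χcu Z s (t • B))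
    {ρb KE KG' KCs' θΓ' θC' θE' am wm : ℝ} (hρb1 : ρb < 1) (hKE : 0 ≤ KE)
    (hCE : ∀ b b', ‖((𝔇.𝒦 Z s).C⁻¹.map (algebraMap ℝ ℂ)) b b'‖ ≤ KE * Real.exp (-(ι.kap * tdist1 𝔇.Nf ((𝔇.𝒦 Z s).locΛ b) ((𝔇.𝒦 Z s).locΛ b'))))
    (hKG' : (1 + ρb) * ι.KG ≤ KG') (hKCs' : ((1 - ρb) ^ 2)⁻¹ * ι.KCs ≤ KCs') (hθΓ' : ι.θΓ + ρb * ι.KG ≤ θΓ')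
    (hθC' : ι.θC + ρb * (2 + ρb) * ((1 - ρb) ^ 2)⁻¹ * ι.KCs ≤ θC') (hθE' : ι.θE + ρb * (2 + ρb) * (ι.θE + KE) ≤ θE')
    (hθEle : θE' ≤ ι.θ) (hθΓle : θΓ' ≤ ι.θ)
    (hθR1le : ((𝔇.𝒦 Z s).m * (1 + 2 / (ι.kap - ι.kap')) ^ 𝔇.ν) * ((𝔇.𝒦 Z s).m * (1 + 2 / (ι.kap' - ι.kap'')) ^ 𝔇.ν)
      * (θΓ' * KCs' * KG' + ι.KΓ * θC' * KG' + ι.KΓ * ι.K₀ * θΓ') ≤ ι.θ)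
    (ha' : (1 + ρb) ^ 2 * (2 * lg.ρ * lg.m₃) ≤ am) (hw' : (1 + ρb) ^ 2 * (∑ Y ∈ s.1, lg.R Y * (lg.c₀ Y + lg.c₁ Y * lg.ρ)) ≤ wm)
    (hαc : (2 * (ι.θ * ((𝔇.𝒦 Z s).m * (1 + 2 / ι.kap'') ^ 𝔇.ν)) + (ι.γ₂ + am)) * ι.cE ≤ 1 / 2)
    (hsmall : (2 * (ι.θ * ((𝔇.𝒦 Z s).m * (1 + 2 / ι.kap'') ^ 𝔇.ν)) + (ι.γ₂ + am)) * (1 + 2 * ι.cE * ι.g) ≤ 1 / 2)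
    (hvol : 2 * (ι.K₀ * ((𝔇.𝒦 Z s).m * (1 + 2 / ι.kap) ^ 𝔇.ν) * (ι.θ * ((𝔇.𝒦 Z s).m * (1 + 2 / ι.kap'') ^ 𝔇.ν))
              * (1 + (1 - ι.K₀ * ((𝔇.𝒦 Z s).m * (1 + 2 / ι.kap) ^ 𝔇.ν) * (ι.θ * ((𝔇.𝒦 Z s).m * (1 + 2 / ι.kap'') ^ 𝔇.ν)))⁻¹) / 2)
          * (Fintype.card (𝔇.𝒦 Z s).Λ : ℝ)
        + wm + (2 * (ι.θ * ((𝔇.𝒦 Z s).m * (1 + 2 / ι.kap'') ^ 𝔇.ν)) + (ι.γ₂ + am)) * ι.cE * (Fintype.card (𝔇.𝒦 Z s).Λ : ℝ)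
        + (2 * (ι.θ * ((𝔇.𝒦 Z s).m * (1 + 2 / ι.kap'') ^ 𝔇.ν)) + (ι.γ₂ + am)) * (1 + 2 * ι.cE * ι.g) * (Fintype.card ((𝔇.𝒦 Z s).Λ ⊕ (𝔇.𝒦 Z s).C₀) : ℝ)
        ≤ a₅ * ((Z.1).card : ℝ)) :
    DifferentiableOn ℂ (fun b : ℂ => 𝔇.memberTF χu χcu 𝒲 𝒪 t Z s b old φ) (ball (1 : ℂ) ρb) ∧
    ∀ b ∈ ball (1 : ℂ) ρb, ‖𝔇.memberTF χu χcu 𝒲 𝒪 t Z s b old φ‖ ≤ weight L M c Z a s * Real.exp (a₅ * ((Z.1).card : ℝ)) :=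
  differentiableOn_and_norm_memberOfDatum_le_weight_of_localGrowth 𝔇 χu χcu 𝒲 𝒪 Z s old φ t c hκ₁ hα₆ ι.hpos ι.hhalf ι.hUσ ι.hUτ ι.hUexp ι.hUtau ι.hr ι.hr'
    ι.hsubτ (hB.nonneg_smul t).1 (hB.nonneg_smul t).2 ht lg.hρ.le ι.hAhol (hB.measurable_smul t).1 (hB.measurable_smul t).2 lg.h𝒲m lg.h𝒪m ι.hAs ι.hGhol
    ι.qP (fun B => by rw [← hEχ B, ← hEχc B]; exact ι.h222 B) ι.hγ₂ ι.hqP lg.hR lg.hc₃ lg.hc₁ lg.hUτR lg.h0 lg.S lg.h1loc lg.h4 lg.hm₃0 lg.hm₃ lg.S₀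
    (lg.hbox_smul t) lg.hloc𝒲 lg.hloc𝒪 ι.hfibN ι.hkap'' ι.h1 ι.h2 ι.hθE ι.hθΓ ι.hθC ι.hKG ι.hKΓ ι.hKCs ι.hK₀ hKE ι.hG ι.hΓ₀ ι.hCs ι.hC216 hCE ι.hdΓ
    ι.hdC ι.hdE hρb1 hKG' hKCs' hθΓ' hθC' hθE' ha' hw' hθEle hθΓle hθR1le ι.hsmallKθ ι.hc0 ι.hc hαc ι.hg ι.hΓq hsmall (a := a) (a₅ := a₅) ι.hPa hvol

/-! ## §2 ★★ (S-vertex-T′)ʷ — the CENTRED letter about the coupling-blind centre — read off the records `(ι, lg)`, by cases on the large-field set -/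

open Classical in
/-- ★★ **THE CENTRED MEMBER LETTER `hMcen` READ OFF ONE `Inputs226Holo` RECORD AND ONE `LocalGrowthInputs` RECORD AT THE HISTORY `old`**: for every `b ∈ ball 1 ρ_b`,
`‖memberTF t Z s b old φ − V‖ ≤ Mv·t²·(weight·e^{a₅|Z|})` about the COUPLING-BLIND centre `V := if |P(s)| = 0 then term(A, Γ, F214 |P| 1 1 𝐃 (Y ↦ 𝒪(old,φ;Y,0))) else 0`
(no base point, no dilation parameter).  On `|P(s)| = 0`: J10b §3 (the centred (2.15) about the boxed reference member from LOCAL growth letters — (L0)–(L6), (ℓ1),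
evenness of the boxes, rate `δ > 0`, closure rows `2δ + 8ρm₃ ≤ a_m`, `hwc ≤ e^{w_m}`) + J7a §1 (the box tail `≤ e^{−½κ_bR_b²}·W` under the box law
`⟨B,B⟩ < R_b² ⇒ χᵘχᶜᵘ(t·B) = 1`, `χᵘχᶜᵘ ≤ 1`, at a rate `0 ≤ κ_b ≤ γ₂ + a_m`) + J7a §2 (the box-free centre is `b`-free) + the rate `e^{−½κ_bR_b²} ≤ T·t²`, `1 + T ≤ Mv`
(`vertexLetter_of_threePieces`); on `|P(s)| ≠ 0`: J10b §4 (the (2.22) surplus `e^{−½γ₂(r_P² − r₁²)}`, `a ≤ γ₂r₁²`) + the rate `≤ T′·t²`, `T′ ≤ Mv` (`vertexLetter_of_largeField`).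
The box block is hypothesised ONLY on `|P| = 0`, the surplus block ONLY on `|P| ≠ 0` (№193).  One application per piece; no estimate proved here.
[cite: Balaban1988RG2Cluster, (1.34)-(1.36) p.9, Lemma 2 (1.41)-(1.43) p.11, (2.2)-(2.3) p.12, (2.14)-(2.15) p.15, (2.16)-(2.22) p.16, (2.23)-(2.26) p.17, (1.26) p.8; Balaban1987RG1, (2.9)-(2.13) pp.266-268] -/
theorem norm_memberTF_sub_centre_le_of_records {c : B13.Consts} (hκ₁ : 1 ≤ c.κ₁) (hα₆ : c.α₆ ≠ 0) (hA6 : 0 ≤ c.α₆ * c.eps2)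
    (Z : (domSys P M (k + 1)).Dom) (s : TermLabel P M k L) (old : OlderTerms P 𝔸 M k) (φ : CPair P 𝔸) {t : ℝ} (ht : 0 < t) {a a₅ : ℝ}
    (ι : 𝔇.Inputs226Holo c Z s (t : ℂ) old φ a a₅) (lg : 𝔇.LocalGrowthInputs χu 𝒲 𝒪 Z s old φ ι.Uτ) (hB : 𝔇.UnscaledBoxLaws χu χcu Z s)
    (hχ1 : ∀ A : (𝔇.𝒦 Z s).Λ → ℝ, χu Z s A * χcu Z s A ≤ 1)
    (hEχ : ∀ B, 𝔇.chiY₀ Z s (t : ℂ) B = χu Z s (t • B)) (hEχc : ∀ B, 𝔇.chicP Z s (t : ℂ) B = χcu Z s (t • B))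
    {ρb KE KG' KCs' θΓ' θC' θE' am wm δ Mv : ℝ} (hρb0 : 0 ≤ ρb) (hρb1 : ρb < 1) (hKE : 0 ≤ KE)
    (hCE : ∀ b b', ‖((𝔇.𝒦 Z s).C⁻¹.map (algebraMap ℝ ℂ)) b b'‖ ≤ KE * Real.exp (-(ι.kap * tdist1 𝔇.Nf ((𝔇.𝒦 Z s).locΛ b) ((𝔇.𝒦 Z s).locΛ b'))))
    (hKG' : (1 + ρb) * ι.KG ≤ KG') (hKCs' : ((1 - ρb) ^ 2)⁻¹ * ι.KCs ≤ KCs') (hθΓ' : ι.θΓ + ρb * ι.KG ≤ θΓ')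
    (hθC' : ι.θC + ρb * (2 + ρb) * ((1 - ρb) ^ 2)⁻¹ * ι.KCs ≤ θC') (hθE' : ι.θE + ρb * (2 + ρb) * (ι.θE + KE) ≤ θE')
    (hθEle : θE' ≤ ι.θ) (hθΓle : θΓ' ≤ ι.θ)
    (hθR1le : ((𝔇.𝒦 Z s).m * (1 + 2 / (ι.kap - ι.kap')) ^ 𝔇.ν) * ((𝔇.𝒦 Z s).m * (1 + 2 / (ι.kap' - ι.kap'')) ^ 𝔇.ν)
      * (θΓ' * KCs' * KG' + ι.KΓ * θC' * KG' + ι.KΓ * ι.K₀ * θΓ') ≤ ι.θ)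
    (ha' : (1 + ρb) ^ 2 * (2 * lg.ρ * lg.m₃) ≤ am) (hw' : (1 + ρb) ^ 2 * (∑ Y ∈ s.1, lg.R Y * (lg.c₀ Y + lg.c₁ Y * lg.ρ)) ≤ wm)
    (hδ : 0 < δ) (hac : 2 * δ + 8 * lg.ρ * lg.m₃ ≤ am)
    (hwc : Real.exp (∑ Y ∈ s.1, lg.R Y * lg.c₀ Y)
        * ((∑ Y ∈ s.1, lg.R Y * ((4 * lg.c₄ Y + (4 * lg.c₃ Y + 4 * lg.c₃' Y) / lg.ρ) * (4 / (Real.exp 1 * δ)) ^ 4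
              + (lg.c₂ Y + (lg.c₁ Y + lg.c₁' Y) / lg.ρ) * (2 / (Real.exp 1 * δ)) ^ 2)) * Real.exp (δ / 2)
           + ((∑ Y ∈ s.1, lg.R Y * (4 * lg.c₃ Y * (3 / (Real.exp 1 * δ)) ^ 3 + lg.c₁ Y * (1 / (Real.exp 1 * δ))))
                * Real.exp (δ / 2)) ^ 2
              * Real.exp ((∑ Y ∈ s.1, lg.R Y * (lg.c₀ Y + lg.c₁ Y * lg.ρ)) + ∑ Y ∈ s.1, lg.R Y * lg.c₀ Y))
        ≤ Real.exp wm)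
    (hαc : (2 * (ι.θ * ((𝔇.𝒦 Z s).m * (1 + 2 / ι.kap'') ^ 𝔇.ν)) + (ι.γ₂ + am)) * ι.cE ≤ 1 / 2)
    (hsmall : (2 * (ι.θ * ((𝔇.𝒦 Z s).m * (1 + 2 / ι.kap'') ^ 𝔇.ν)) + (ι.γ₂ + am)) * (1 + 2 * ι.cE * ι.g) ≤ 1 / 2)
    (hvol : 2 * (ι.K₀ * ((𝔇.𝒦 Z s).m * (1 + 2 / ι.kap) ^ 𝔇.ν) * (ι.θ * ((𝔇.𝒦 Z s).m * (1 + 2 / ι.kap'') ^ 𝔇.ν))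
              * (1 + (1 - ι.K₀ * ((𝔇.𝒦 Z s).m * (1 + 2 / ι.kap) ^ 𝔇.ν) * (ι.θ * ((𝔇.𝒦 Z s).m * (1 + 2 / ι.kap'') ^ 𝔇.ν)))⁻¹) / 2)
          * (Fintype.card (𝔇.𝒦 Z s).Λ : ℝ)
        + wm + (2 * (ι.θ * ((𝔇.𝒦 Z s).m * (1 + 2 / ι.kap'') ^ 𝔇.ν)) + (ι.γ₂ + am)) * ι.cE * (Fintype.card (𝔇.𝒦 Z s).Λ : ℝ)
        + (2 * (ι.θ * ((𝔇.𝒦 Z s).m * (1 + 2 / ι.kap'') ^ 𝔇.ν)) + (ι.γ₂ + am)) * (1 + 2 * ι.cE * ι.g) * (Fintype.card ((𝔇.𝒦 Z s).Λ ⊕ (𝔇.𝒦 Z s).C₀) : ℝ)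
        ≤ a₅ * ((Z.1).card : ℝ))
    -- the box block, ONLY for a term without large-field boxes: the box law at the base point, a rate `κ_b`, the rate of the box tail against `t²`
    (hbox0 : s.2.card = 0 → ∃ κb Rb T : ℝ, 0 ≤ κb ∧ κb ≤ ι.γ₂ + am ∧
      (∀ B : (𝔇.𝒦 Z s).Λ → ℝ, B ⬝ᵥ B < Rb ^ 2 → χu Z s (t • B) * χcu Z s (t • B) = 1) ∧
      Real.exp (-(κb / 2 * Rb ^ 2)) ≤ T * t ^ 2 ∧ 1 + T ≤ Mv)
    -- the surplus block, ONLY for a term with large-field boxes: a smaller (2.22) radius matching `a`, the rate of the surplus against `t²`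
    (hsur : s.2.card ≠ 0 → ∃ r₁ T' : ℝ, r₁ ^ 2 ≤ ι.rP ^ 2 ∧ a ≤ ι.γ₂ * r₁ ^ 2 ∧
      Real.exp (-(ι.γ₂ / 2 * (ι.rP ^ 2 - r₁ ^ 2))) ≤ T' * t ^ 2 ∧ T' ≤ Mv) :
    ∀ b ∈ ball (1 : ℂ) ρb, ‖𝔇.memberTF χu χcu 𝒲 𝒪 t Z s b old φ
        - (if s.2.card = 0 then term214 𝔇.r (sigmaList L Z s) (tauList P M k L s)
            (core214 (𝔇.A Z s φ) (𝔇.Gam Z s φ) (F214 s.2.card (fun _ => (1 : ℝ)) (fun _ => (1 : ℝ)) s.1 (fun Y _ => 𝒪 Z s old φ Y 0))) 0 0 else 0)‖ ≤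
      Mv * t ^ 2 * (weight L M c Z a s * Real.exp (a₅ * ((Z.1).card : ℝ))) := by
  intro b hb
  have hW : 0 ≤ weight L M c Z a s * Real.exp (a₅ * ((Z.1).card : ℝ)) := mul_nonneg (weight_nonneg c Z a hA6 s) (Real.exp_pos _).le
  have htW : 0 ≤ t ^ 2 * (weight L M c Z a s * Real.exp (a₅ * ((Z.1).card : ℝ))) := mul_nonneg (sq_nonneg _) hW
  have hρm : 0 ≤ 2 * lg.ρ * lg.m₃ := mul_nonneg (mul_nonneg two_pos.le lg.hρ.le) lg.hm₃0
  have ham0 : 0 ≤ am := (mul_nonneg (sq_nonneg _) hρm).trans ha'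
  have hγam : 0 ≤ ι.γ₂ + am := add_nonneg ι.hγ₂ ham0
  have hRc₀ : ∑ Y ∈ s.1, lg.R Y * lg.c₀ Y ≤ wm := sum_R_c₀_le_of_primedWidth lg hρb0 hw'
  have hχ0 := (hB.nonneg_smul t).1
  have hχc0 := (hB.nonneg_smul t).2
  have hχm := (hB.measurable_smul t).1
  have hχcm := (hB.measurable_smul t).2
  have h222 : ∀ B : (𝔇.𝒦 Z s).Λ → ℝ, χu Z s (t • B) * χcu Z s (t • B) ≤ Real.exp (-(ι.γ₂ / 2 * ι.rP ^ 2 * (s.2.card : ℕ)) + ι.γ₂ / 2 * ι.qP B) :=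
    fun B => by rw [← hEχ B, ← hEχc B]; exact ι.h222 B
  by_cases hP : s.2.card = 0
  · -- |P(s)| = 0: the three pieces
    rw [if_pos hP]
    obtain ⟨κb, Rb, T, hκb0, hκb, hboxR, hRb, hMvT⟩ := hbox0 hP
    have e : κb + (ι.γ₂ + am - κb) = ι.γ₂ + am := by ring
    have ha₀b : 0 ≤ ι.γ₂ + am - κb := sub_nonneg.2 hκb
    have hαc_b : (2 * (ι.θ * ((𝔇.𝒦 Z s).m * (1 + 2 / ι.kap'') ^ 𝔇.ν)) + (κb + (ι.γ₂ + am - κb))) * ι.cE ≤ 1 / 2 := by rw [e]; exact hαc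
    have hsmall_b : (2 * (ι.θ * ((𝔇.𝒦 Z s).m * (1 + 2 / ι.kap'') ^ 𝔇.ν)) + (κb + (ι.γ₂ + am - κb))) * (1 + 2 * ι.cE * ι.g) ≤ 1 / 2 := by
      rw [e]; exact hsmall
    have hvol_b : 2 * (ι.K₀ * ((𝔇.𝒦 Z s).m * (1 + 2 / ι.kap) ^ 𝔇.ν) * (ι.θ * ((𝔇.𝒦 Z s).m * (1 + 2 / ι.kap'') ^ 𝔇.ν))
              * (1 + (1 - ι.K₀ * ((𝔇.𝒦 Z s).m * (1 + 2 / ι.kap) ^ 𝔇.ν) * (ι.θ * ((𝔇.𝒦 Z s).m * (1 + 2 / ι.kap'') ^ 𝔇.ν)))⁻¹) / 2)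
          * (Fintype.card (𝔇.𝒦 Z s).Λ : ℝ)
        + wm + (2 * (ι.θ * ((𝔇.𝒦 Z s).m * (1 + 2 / ι.kap'') ^ 𝔇.ν)) + (κb + (ι.γ₂ + am - κb))) * ι.cE * (Fintype.card (𝔇.𝒦 Z s).Λ : ℝ)
        + (2 * (ι.θ * ((𝔇.𝒦 Z s).m * (1 + 2 / ι.kap'') ^ 𝔇.ν)) + (κb + (ι.γ₂ + am - κb))) * (1 + 2 * ι.cE * ι.g)
          * (Fintype.card ((𝔇.𝒦 Z s).Λ ⊕ (𝔇.𝒦 Z s).C₀) : ℝ)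
        ≤ a₅ * ((Z.1).card : ℝ) := by rw [e]; exact hvol
    have h3 := vertexLetter_of_threePieces hW
      (norm_memberOfDatum_sub_boxedCentre_le_of_localGrowth 𝔇 χu χcu 𝒲 𝒪 Z s old φ t c hκ₁ hα₆ ι.hpos ι.hhalf ι.hUσ ι.hUτ ι.hUexp ι.hUtau ι.hr ι.hr'
        ι.hsubτ hχ0 hχc0 (hB.even_smul t).1 (hB.even_smul t).2 lg.𝒲₃ lg.D𝒪 ht lg.hρ lg.h𝒲m lg.h𝒪m lg.h𝒲₃m lg.hD𝒪m lg.h𝒲₃ lg.hD𝒪 ι.hAhol hχm hχcm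
        ι.hAs ι.hGhol ι.qP h222 ι.hγ₂ ι.hqP hδ lg.hR lg.hc₃ lg.hc₃' lg.hc₄ lg.hc₁ lg.hc₁' lg.hc₂ lg.hUτR lg.h0 lg.h1 lg.S lg.h1loc lg.hm₃0 lg.hm₃ lg.h2 lg.h3
        lg.h4 lg.h5 lg.h6 lg.S₀ (lg.hbox_smul t) lg.hloc𝒲 lg.hloc𝒪 hac hwc ι.hfibN ι.hkap'' ι.h1 ι.h2 ι.hθE ι.hθΓ ι.hθC ι.hKG ι.hKΓ ι.hKCs ι.hK₀ hKE ι.hG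
        ι.hΓ₀ ι.hCs ι.hC216 hCE ι.hdΓ ι.hdC ι.hdE hρb1 hKG' hKCs' hθΓ' hθC' hθE' hθEle hθΓle hθR1le ι.hsmallKθ ι.hc0 ι.hc hαc ι.hg ι.hΓq hsmall (a := a)
        (a₅ := a₅) ι.hPa hvol hb)
      (norm_boxTail_memberOfDatum_le_of_primitives 𝔇 χu χcu 𝒪 Z s old φ t c hκ₁ hα₆ ι.hpos ι.hhalf ι.hUσ ι.hUτ ι.hUexp ι.hUtau ι.hr ι.hr' ι.hsubτ hχ0 hχc0
        (fun B => hχ1 (t • B)) hκb0 hboxR ι.hAhol hχm hχcm (fun _ => measurable_const) ι.hAs ι.hGhol hP ha₀b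
        (sum_tau_older_zero_le_quadratic_of_localGrowth lg ha₀b hRc₀) ι.hfibN ι.hkap'' ι.h1 ι.h2 ι.hθE ι.hθΓ ι.hθC ι.hKG ι.hKΓ ι.hKCs ι.hK₀ hKE ι.hG
        ι.hΓ₀ ι.hCs ι.hC216 hCE ι.hdΓ ι.hdC ι.hdE hρb1 hKG' hKCs' hθΓ' hθC' hθE' hθEle hθΓle hθR1le ι.hsmallKθ ι.hc0 ι.hc hαc_b ι.hg ι.hΓq hsmall_b (a := a)
        (a₅ := a₅) hvol_b hb)
      (boxFreeCentre_memberOfDatum_eq_of_primitives 𝔇 𝒪 Z s old φ c ι.hUσ ι.hUτ ι.hUexp ι.hr ι.hr' ι.hsubτ ι.hAhol ι.hAs ι.hGhol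
        (norm_sum_tau_older_zero_le_of_localGrowth lg hRc₀) ι.hfibN ι.hkap'' ι.h1 ι.h2 ι.hθE ι.hθΓ ι.hθC ι.hKG ι.hKΓ ι.hKCs ι.hK₀ hKE ι.hG ι.hΓ₀ ι.hCs
        ι.hC216 hCE ι.hdΓ ι.hdC ι.hdE hρb1 hKG' hKCs' hθΓ' hθC' hθE' hθEle hθΓle hθR1le ι.hsmallKθ ι.hc0 ι.hc hγam hαc ι.hΓq hsmall b hb) hRb
    exact le_rate_of_le_rate htW h3 hMvT
  · -- |P(s)| ≠ 0: the (2.22) surplus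
    rw [if_neg hP]
    obtain ⟨r₁, T', hr₁, hPa1, hTP, hMvP⟩ := hsur hP
    have hP1 : 1 ≤ s.2.card := Nat.one_le_iff_ne_zero.2 hP
    have hL := vertexLetter_of_largeField hW
      (norm_memberOfDatum_le_largeField_of_localGrowth 𝔇 χu χcu 𝒲 𝒪 Z s old φ t c hκ₁ hα₆ ι.hpos ι.hhalf ι.hUσ ι.hUτ ι.hUexp ι.hUtau ι.hr ι.hr' ι.hsubτ
        hχ0 hχc0 ht lg.hρ.le ι.hAhol hχm hχcm lg.h𝒲m lg.h𝒪m ι.hAs ι.hGhol ι.qP h222 ι.hγ₂ ι.hqP hr₁ hP1 lg.hR lg.hc₃ lg.hc₁ lg.hUτR lg.h0 lg.S lg.h1loc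
        lg.h4 lg.hm₃0 lg.hm₃ lg.S₀ (lg.hbox_smul t) lg.hloc𝒲 lg.hloc𝒪 ι.hfibN ι.hkap'' ι.h1 ι.h2 ι.hθE ι.hθΓ ι.hθC ι.hKG ι.hKΓ ι.hKCs ι.hK₀ hKE ι.hG ι.hΓ₀
        ι.hCs ι.hC216 hCE ι.hdΓ ι.hdC ι.hdE hρb1 hKG' hKCs' hθΓ' hθC' hθE' ha' hw' hθEle hθΓle hθR1le ι.hsmallKθ ι.hc0 ι.hc hαc ι.hg ι.hΓq hsmall (a := a)
        (a₅ := a₅) hPa1 hvol b hb) hTP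
    exact le_rate_of_le_rate htW hL hMvP

/-! ## §3 ★ The centre's own (2.26) weight `hT₀` — J8 at the constant curve -/

open Classical in
/-- ★ **THE COUPLING-BLIND CENTRE's (2.26) WEIGHT `hT₀` READ OFF THE RECORDS `(ι, lg)` AT THE HISTORY `old`**:
`‖if |P(s)| = 0 then term(A, Γ, F214 |P| 1 1 𝐃 (Y ↦ 𝒪(old,φ;Y,0))) else 0‖ ≤ weight L M c Z a s · e^{a₅|Z|}` — on `|P| = 0` module J8 `differentiableOn_and_norm_centreOfDatum_of_primitives`
(W1-8's engine at `χ := 1`, `Re A ≻ 0` = `ι.hA`, UNPRIMED θ-rows of `ι`, (2.22) free) along the CONSTANT curve `z ↦ old` with the centre's quadratic-form letter of §0 at the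
master rate; `0 ≤ weight` otherwise.  The `t`-free statement holds for a record at ANY base point (the consumer instantiates `t := γ`).  One application; nothing estimated here.
[cite: Balaban1988RG2Cluster, (1.41) p.11, (2.14)-(2.15) p.15, (2.16)-(2.22) p.16, (2.23)-(2.26) p.17; Balaban1987RG1, (2.12)-(2.13) p.268] -/
theorem norm_centre_le_weight_of_records {c : B13.Consts} (hκ₁ : 1 ≤ c.κ₁) (hα₆ : c.α₆ ≠ 0) (hA6 : 0 ≤ c.α₆ * c.eps2)
    (Z : (domSys P M (k + 1)).Dom) (s : TermLabel P M k L) (old : OlderTerms P 𝔸 M k) (φ : CPair P 𝔸) {t : ℝ} {a a₅ : ℝ}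
    (ι : 𝔇.Inputs226Holo c Z s (t : ℂ) old φ a a₅) (lg : 𝔇.LocalGrowthInputs χu 𝒲 𝒪 Z s old φ ι.Uτ)
    {ρb am wm : ℝ} (hρb0 : 0 ≤ ρb)
    (ha' : (1 + ρb) ^ 2 * (2 * lg.ρ * lg.m₃) ≤ am) (hw' : (1 + ρb) ^ 2 * (∑ Y ∈ s.1, lg.R Y * (lg.c₀ Y + lg.c₁ Y * lg.ρ)) ≤ wm)
    (hαc : (2 * (ι.θ * ((𝔇.𝒦 Z s).m * (1 + 2 / ι.kap'') ^ 𝔇.ν)) + (ι.γ₂ + am)) * ι.cE ≤ 1 / 2)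
    (hsmall : (2 * (ι.θ * ((𝔇.𝒦 Z s).m * (1 + 2 / ι.kap'') ^ 𝔇.ν)) + (ι.γ₂ + am)) * (1 + 2 * ι.cE * ι.g) ≤ 1 / 2)
    (hvol : 2 * (ι.K₀ * ((𝔇.𝒦 Z s).m * (1 + 2 / ι.kap) ^ 𝔇.ν) * (ι.θ * ((𝔇.𝒦 Z s).m * (1 + 2 / ι.kap'') ^ 𝔇.ν))
              * (1 + (1 - ι.K₀ * ((𝔇.𝒦 Z s).m * (1 + 2 / ι.kap) ^ 𝔇.ν) * (ι.θ * ((𝔇.𝒦 Z s).m * (1 + 2 / ι.kap'') ^ 𝔇.ν)))⁻¹) / 2)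
          * (Fintype.card (𝔇.𝒦 Z s).Λ : ℝ)
        + wm + (2 * (ι.θ * ((𝔇.𝒦 Z s).m * (1 + 2 / ι.kap'') ^ 𝔇.ν)) + (ι.γ₂ + am)) * ι.cE * (Fintype.card (𝔇.𝒦 Z s).Λ : ℝ)
        + (2 * (ι.θ * ((𝔇.𝒦 Z s).m * (1 + 2 / ι.kap'') ^ 𝔇.ν)) + (ι.γ₂ + am)) * (1 + 2 * ι.cE * ι.g) * (Fintype.card ((𝔇.𝒦 Z s).Λ ⊕ (𝔇.𝒦 Z s).C₀) : ℝ)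
        ≤ a₅ * ((Z.1).card : ℝ)) :
    ‖(if s.2.card = 0 then term214 𝔇.r (sigmaList L Z s) (tauList P M k L s)
        (core214 (𝔇.A Z s φ) (𝔇.Gam Z s φ) (F214 s.2.card (fun _ => (1 : ℝ)) (fun _ => (1 : ℝ)) s.1 (fun Y _ => 𝒪 Z s old φ Y 0))) 0 0 else 0)‖ ≤
      weight L M c Z a s * Real.exp (a₅ * ((Z.1).card : ℝ)) := by
  have hW : 0 ≤ weight L M c Z a s * Real.exp (a₅ * ((Z.1).card : ℝ)) := mul_nonneg (weight_nonneg c Z a hA6 s) (Real.exp_pos _).le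
  have hρm : 0 ≤ 2 * lg.ρ * lg.m₃ := mul_nonneg (mul_nonneg two_pos.le lg.hρ.le) lg.hm₃0
  have ham0 : 0 ≤ am := (mul_nonneg (sq_nonneg _) hρm).trans ha'
  have hRc₀ : ∑ Y ∈ s.1, lg.R Y * lg.c₀ Y ≤ wm := sum_R_c₀_le_of_primedWidth lg hρb0 hw'
  by_cases hP : s.2.card = 0
  · rw [if_pos hP]
    exact (differentiableOn_and_norm_centreOfDatum_of_primitives 𝔇 𝒪 Z s φ hP isOpen_univ (fun _ => old) (fun _ => differentiableOn_const _) c hκ₁ hα₆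
      ι.hpos ι.hhalf ι.hUσ ι.hUτ ι.hUexp ι.hUtau ι.hr ι.hr' ι.hsubτ ι.hAhol ι.hAs ι.hA ι.hGhol (rP := ι.rP) (a₂₀ := am) (w := wm) ι.hγ₂ ham0 ι.hfibN
      ι.hkap'' ι.h1 ι.h2 ι.hθE ι.hθΓ ι.hθC ι.hKG ι.hKΓ ι.hKCs ι.hK₀ ι.hθEle ι.hθΓle ι.hθR1le ι.hG ι.hΓ₀ ι.hCs ι.hC216 ι.hdΓ ι.hdC ι.hdE ι.hsmallKθ ι.hc0
      ι.hc hαc ι.hg ι.hΓq hsmall (a := a) (a₅ := a₅) ι.hPa hvol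
      (fun _ _ => sum_tau_older_zero_le_quadratic_of_localGrowth lg ham0 hRc₀)).2 0 (mem_univ _)
  · rw [if_neg hP, norm_zero]; exact hW

end YMDAG.N22.W1

end
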